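import Summits.MatrixMultiplication.OmegaCensus.STPPVosperSlackFourTablesZ61P1
import Summits.MatrixMultiplication.OmegaCensus.STPPVosperTilingWordsPrunedQ
import Summits.MatrixMultiplication.OmegaCensus.STPPVosperSlackTwoLawABQ

/-!
# ω-census (abelian STPP census): fifth leaf ℤ₆₁ {(2,2,2),(3,3,3)²} — dead-table rows for `tblZ61F5A0`, part 9 of 13 (kernel computations)

HONEST FRAMING (pub-omega census; verbatim): lottery ticket; floor = certified bounds/negative ranges.
Census STRUCTURE (seat pub-omega-stpp-2 gen 27 — rows service for the stpp-1 lineage's law, 2026-08-29), family (b2).  For each entry `e = (Yo, Zo)` of stpp-1 g33's dead table `tblZ61F5A0` (`STPPVosperSlackFourTablesZ61P1.lean`, 250 entries) the words-cover search of the two other blocks (3,3,3), (2,2,2) over stpp-2 g26's pruned enumerator `blockDiffsWQ` (direct orientation) returns `false` (≤ 3·10⁴ mirror steps each); g33's `coverDead_forall_of_rows` turns the assembled row into the law's `CoverDead` hypothesis.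
Each theorem is ONE `decide +kernel` over a range of table entries.  Assembly in `STPPVosperSlackFourRows61F5TblA0Asm.lean`.  Nothing here is progress on `ω`.
-/

namespace Summit.MatrixMultiplication.OmegaCensus.CubeNB.S2

open Summit.MatrixMultiplication.OmegaCensus.CubeNB

/-- Dead-table entries `[160, 164)` of `tblZ61F5A0`: the words-cover search fails. [folklore] -/
theorem dead61TblA0_c40 : ∀ e ∈ (tblZ61F5A0.drop 160).take 4, existsCoverW 61 e.1 e.2 [blockDiffsWQ 61 e.1 e.2 3 3 3, blockDiffsWQ 61 e.1 e.2 2 2 2] [] [] [] = false := by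
  decide +kernel

/-- Dead-table entries `[164, 168)` of `tblZ61F5A0`: the words-cover search fails. [folklore] -/
theorem dead61TblA0_c41 : ∀ e ∈ (tblZ61F5A0.drop 164).take 4, existsCoverW 61 e.1 e.2 [blockDiffsWQ 61 e.1 e.2 3 3 3, blockDiffsWQ 61 e.1 e.2 2 2 2] [] [] [] = false := by
  decide +kernel

/-- Dead-table entries `[168, 172)` of `tblZ61F5A0`: the words-cover search fails. [folklore] -/
theorem dead61TblA0_c42 : ∀ e ∈ (tblZ61F5A0.drop 168).take 4, existsCoverW 61 e.1 e.2 [blockDiffsWQ 61 e.1 e.2 3 3 3, blockDiffsWQ 61 e.1 e.2 2 2 2] [] [] [] = false := by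
  decide +kernel

/-- Dead-table entries `[172, 176)` of `tblZ61F5A0`: the words-cover search fails. [folklore] -/
theorem dead61TblA0_c43 : ∀ e ∈ (tblZ61F5A0.drop 172).take 4, existsCoverW 61 e.1 e.2 [blockDiffsWQ 61 e.1 e.2 3 3 3, blockDiffsWQ 61 e.1 e.2 2 2 2] [] [] [] = false := by
  decide +kernel

/-- Dead-table entries `[176, 180)` of `tblZ61F5A0`: the words-cover search fails. [folklore] -/
theorem dead61TblA0_c44 : ∀ e ∈ (tblZ61F5A0.drop 176).take 4, existsCoverW 61 e.1 e.2 [blockDiffsWQ 61 e.1 e.2 3 3 3, blockDiffsWQ 61 e.1 e.2 2 2 2] [] [] [] = false := by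
  decide +kernel

end Summit.MatrixMultiplication.OmegaCensus.CubeNB.S2
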